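import Summits.BirchSwinnertonDyer.Rank1Residual.Additive.X3BranchResidualLineH1LowerBound
import HarnessLib

/-!
# X3, the DEGENERATE rows OFF the sub-locus: COUNTING classes of `H¹(H, Φ)` (trivial action) from an
# injectivity statement on their COCYCLE VALUES (cell `bsd-eis`, seat `bsd-eis-x3` gen 7; the counting
# half of the T-side over the first layer (MEMO-9 §2.4 (f), step F8): gen 6's
# `TrivialLineClasses.pow_card_le_natCard_of_classes` wants TEST ELEMENTS `τ_i` with
# `c_i(τ_j) = δ_ij·x₀`, which the layer characters do not come with; this file replaces them by the
# abstract statement «the value functions are independent mod `p`» that the Kummer-injectivity step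
# (the successor's F5) proves; route K1 `AdditiveBranchIMC`, crux `GordTwoRankZeroOffCaseOne` —
# supports only)

HONEST FRAMING (`run/shared/lean/pub/bsd-eis/README.md` §4): THEOREMS ONLY (no `def`, no named fact,
no `sorry`); nothing is booked; no label, tier or count of record moves.

* `pow_card_le_natCard_of_classes_of_injective` — `X ≤ H¹(H, Φ)` finite, classes `c_i ∈ X` with
  cocycles `χ_i : H → Φ`; if `k ↦ (h ↦ Σ (k i).val • χ_i h)` is injective on `(ℤ/p)^ι`, then
  `p^{#ι} ≤ #X`.
References: [SerreGaloisCohomology1997] I.§2; [GreenbergVatsal2000] §2 pp. 28–30.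
-/

set_option autoImplicit false

noncomputable section

open scoped Classical AddSubgroup

namespace Summit.BirchSwinnertonDyer.Rank1Residual.Additive

namespace TrivialLineClasses

open Field NumberField Literature.NumberTheory.GaloisRepresentations Literature.NumberTheory.EllipticCurves

universe u

variable {K : Type u} [Field K] (H : Subgroup (absoluteGaloisGroup K))
  {Φ : Type u} [AddCommGroup Φ] [DistribMulAction (absoluteGaloisGroup K) Φ]
  [TopologicalSpace Φ] [DiscreteTopology Φ]

/-- **Counting exhibited classes from the independence of their cocycle values.** `X ≤ H¹(H, Φ)`
finite (trivial action), `c : ι → X` classes with cocycles `χ i : H → Φ`; if two coefficient vectors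
`k, k' : ι → ℤ/p` giving the same value function `h ↦ Σ (k i).val • χ i h` are equal, then
`k ↦ Σ (k i).val • c i` is injective and `p^{#ι} ≤ #X`. [folklore] -/
theorem pow_card_le_natCard_of_classes_of_injective (htrivH : ∀ (h : H) (x : Φ), h • x = x)
    {p : ℕ} [Fact p.Prime] (X : AddSubgroup (subgroupH1 H Φ)) [Finite X] {ι : Type} [Fintype ι]
    (c : ι → subgroupH1 H Φ) (hc : ∀ i, c i ∈ X) (χ : ι → H → Φ)
    (hχ : ∀ i (h : H), (cocycleOf H Φ htrivH (c i)).1 h = χ i h)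
    (hinj : ∀ k k' : ι → ZMod p,
      (∀ h : H, (∑ i, (k i).val • χ i h) = ∑ i, (k' i).val • χ i h) → k = k') :
    p ^ Fintype.card ι ≤ Nat.card X := by
  let F : (ι → ZMod p) → X := fun k ↦ ⟨∑ i, (k i).val • c i,
    X.sum_mem fun i _ ↦ X.nsmul_mem (hc i) _⟩
  have heval : ∀ k : ι → ZMod p, ∀ h : H,
      (cocycleOf H Φ htrivH (∑ i, (k i).val • c i)).1 h = ∑ i, (k i).val • χ i h := fun k h ↦ by
    rw [cocycleOf_sum_apply H htrivH Finset.univ (fun i ↦ (k i).val • c i) h]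
    refine Finset.sum_congr rfl fun i _ ↦ ?_
    rw [cocycleOf_nsmul_apply H htrivH, hχ]
  have hF : Function.Injective F := by
    intro k k' hkk'
    have hsum : (∑ i, (k i).val • c i) = ∑ i, (k' i).val • c i := congrArg Subtype.val hkk'
    refine hinj k k' fun h ↦ ?_
    have hh := congrArg (fun z : subgroupH1 H Φ ↦ (cocycleOf H Φ htrivH z).1 h) hsum
    simp only at hh
    rwa [heval k h, heval k' h] at hh
  have h := Nat.card_le_card_of_injective F hF
  rwa [Nat.card_fun, Nat.card_zmod, Nat.card_eq_fintype_card] at h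

end TrivialLineClasses

end Summit.BirchSwinnertonDyer.Rank1Residual.Additive

end
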